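import Mathlib.GroupTheory.Index
import Mathlib.LinearAlgebra.FiniteDimensional.Lemmas
import Mathlib.RepresentationTheory.Coinduced
import Mathlib.RepresentationTheory.Irreducible
import HarnessLib

/-!
# The index bound: the Helly number of degeneracy is at most the index of an abelian subgroup

COR-CM (cell `pub-hodgecm2`, binder seat `b16` gen 59, count-neutral claim INDEX BOUND, file F1 — abstract level;
theorems only, no definition, no named fact, no `sorry`).  NEW as stated, hence under `Summits/`.  HONEST FRAMING:
unconditional finite-dimensional linear algebra over `ℚ` feeding the rank of families of CM types (= `dim` of the
Mumford–Tate group of a product of CM abelian varieties); `HC_CM` is neither used nor asserted.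

THE HELLY NUMBER (seat gen 58, `CorCM/IrreducibleOddWeightsHelly`): pairwise non-isomorphic irreducible
`ℚ`-representations `(π_k, V_k)` of `G` covering the members of a family of CM types, and `q` with `d_k ≤ q · δ_k`
(`d_k = dim_ℚ V_k`, `δ_k = dim_ℚ End_G V_k`) ⟹ the family is nondegenerate iff every sub-family of `≤ q + 1` members
is.  Gen 58 supplied `q` from a Wedderburn CERTIFICATE (`d_k / δ_k = r_k = dim_{Z_k} V_k`), i.e. from an explicit list
of the irreducible representations.  THIS FILE removes the list:

* §1 **`finrank_intertwiningMap_mul_finrank_le`** — for an irreducible `(π, V)` and ANY finite-dimensional `(σ, M)`: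
  `dim Hom_G(V, M) · dim V ≤ dim M · dim End_G(V)` (induction on `dim M` through the quotient by the image of one
  non-zero `V → M`; the kernel of `Hom_G(V, M) → Hom_G(V, M/f(V))` is `f ∘ End_G(V)`).
* §2 **`finrank_le_index_mul_finrank_intertwiningMap`** — THE INDEX BOUND: if `A ≤ G` has finite index and acts on
  the irreducible `V` through PAIRWISE COMMUTING operators (e.g. `A` abelian, or `G → G₀` onto a finite group and `A`
  the preimage of an abelian subgroup of `G₀`), then `dim_ℚ V ≤ [G : A] · dim_ℚ End_G(V)`, i.e. `dim_D V ≤ [G : A]` for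
  the division algebra `D = End_G(V)` — the rational form of «the degree of an irreducible representation is at most
  the index of an abelian subgroup».  PROOF without characters or scalar extension: a maximal proper `A`-stable
  `W < V` gives an `A`-irreducible quotient `Q = V/W` (`f = dim Q`); the span `R` of the image of `A` in `End(Q)` is
  commutative and `R · q₀ = Q` for any `q₀ ≠ 0`, so `dim R ≥ f`; `x ↦ (v ↦ (h ↦ x(π(h)v mod W)))` embeds `R` into
  `Hom_G(V, Coind_A^G Q)` and `dim Coind_A^G Q ≤ [G:A] · f` (restriction to coset representatives); §1 then gives
  `f · dim V ≤ dim R · dim V ≤ [G:A] · f · dim End_G(V)`.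
* `finrank_le_index_mul_finrank_intertwiningMap_of_comm` (`A` abelian) and `finrank_eq_finrank_intertwiningMap_of_comm`
  (the whole group acts through commuting operators: `dim_ℚ V = dim_ℚ End_G(V)`, a line over `D`).

The sequel F2 `CorCM/IrreducibleOddWeightsIndexHelly` feeds the bound into the Helly number (a family of CM types covered
by irreducibles on which a finite-index `A ≤ G` acts through commuting operators is nondegenerate iff every sub-family of
at most `[G:A] + 1` members is — `[G:A] = 1`: PAIRS, `[G:A] = 2` (dihedral, quaternion, semidihedral, … images):
TRIPLES), proves that a covering list of irreducibles always EXISTS (so that no representation has to be listed), and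
F3 `…IndexHellyCMFields` reads the result on CM fields inside a Galois field `L`: the Helly number of
`Hg(∏ A_i) = ∏ Hg(A_i)` is at most the index of an abelian subgroup of `Gal(L/ℚ)`.

## References

* [Serre1977] J.-P. Serre, *Linear Representations of Finite Groups*, GTM 42 (1977), §2.2 Prop. 4 (Schur), §3.1 Cor. to
  Thm. 9 (degree `≤ (G : A)` for `A` abelian), §7.2 (induced representations, Frobenius reciprocity), §12.2.
* [Mai1989] L. Mai, *Lower bounds for the ranks of CM types*, J. Number Theory 32 (1989), §2 Prop. 1.
* [Gordon1999HodgeAVSurvey] B. B. Gordon, *A survey of the Hodge conjecture for abelian varieties*, §3, 7.5–7.7.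

Provenance: Literature home (family `hodge`, namespace `Literature.RepresentationTheory.IrrOdd`) of the Summits-side `CorCM/IrreducibleOddWeightsIndexBound` (cell `pub-hodgecm2`, COR-CM; all its imports are `Literature/` and Mathlib), which `Literature/` may not import; theorems only, no named fact, no definition. Nothing here bears on `HC_CM`. Lane `lit-hodgefound` (Layer A3: CM types, their Kubota ranks and Galois combinatorics), seat p20.
-/

set_option autoImplicit false

noncomputable section

open scoped BigOperators

universe u' v w

namespace Literature.RepresentationTheory.IrrOdd

variable {G : Type w} [Group G]

/-! ### §1 `dim Hom_G(V, M) · dim V ≤ dim M · dim End_G(V)` for `V` irreducible -/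

section HomCount

variable {V : Type u'} [AddCommGroup V] [Module ℚ V] [FiniteDimensional ℚ V]

omit [FiniteDimensional ℚ V] in
/-- An irreducible representation lives on a non-zero space (`⊥ ≠ ⊤` among its subrepresentations).
[cite: Serre1977, §2.2 Prop. 4] -/
theorem nontrivial_of_isIrreducible (π : Representation ℚ G V) (hπ : π.IsIrreducible) : Nontrivial V := by
  by_contra h
  haveI : Subsingleton V := not_nontrivial_iff_subsingleton.1 h
  have hbt : (⊥ : Subrepresentation π) = ⊤ :=
    Subrepresentation.toSubmodule_injective (Subsingleton.elim _ _)
  exact hπ.bot_ne_top hbt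

/-- **`dim_ℚ Hom_G(V, M) · dim_ℚ V ≤ dim_ℚ M · dim_ℚ End_G(V)`** for an IRREDUCIBLE finite-dimensional `ℚ`-representation
`(π, V)` and any finite-dimensional `(σ, M)` of the same group (no semisimplicity needed): if `f : V → M` is a non-zero
equivariant map (injective by Schur), the equivariant maps `V → M` landing in `f(V)` are exactly `f ∘ End_G(V)`, and
the others are detected in `M / f(V)`; induct on `dim M`.  (For `G` finite this is the multiplicity count
`Hom_G(V, M) ≅ D^a`, `a · dim V ≤ dim M`.) [cite: Serre1977, §2.2 Prop. 4] -/
theorem finrank_intertwiningMap_mul_finrank_le (π : Representation ℚ G V) (hπ : π.IsIrreducible)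
    {M : Type v} [AddCommGroup M] [Module ℚ M] [FiniteDimensional ℚ M] (σ : Representation ℚ G M) :
    Module.finrank ℚ (π.IntertwiningMap σ) * Module.finrank ℚ V ≤
      Module.finrank ℚ M * Module.finrank ℚ (π.IntertwiningMap π) := by
  suffices key : ∀ (n : ℕ) (M : Type v) [AddCommGroup M] [Module ℚ M] [FiniteDimensional ℚ M]
      (σ : Representation ℚ G M), Module.finrank ℚ M ≤ n →
      Module.finrank ℚ (π.IntertwiningMap σ) * Module.finrank ℚ V ≤
        Module.finrank ℚ M * Module.finrank ℚ (π.IntertwiningMap π) from key _ M σ le_rfl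
  haveI := hπ
  haveI := nontrivial_of_isIrreducible π hπ
  intro n
  induction n with
  | zero =>
    intro M _ _ _ σ hM
    haveI : Subsingleton M := Module.finrank_zero_iff.1 (Nat.le_zero.1 hM)
    haveI : Subsingleton (π.IntertwiningMap σ) :=
      ⟨fun f g => Representation.IntertwiningMap.ext (LinearMap.ext fun v => Subsingleton.elim _ _)⟩
    rw [Module.finrank_zero_of_subsingleton, zero_mul]
    exact Nat.zero_le _
  | succ n ih =>
    intro M _ _ _ σ hM
    by_cases h0 : ∀ f : π.IntertwiningMap σ, f = 0
    · haveI : Subsingleton (π.IntertwiningMap σ) := ⟨fun f g => by rw [h0 f, h0 g]⟩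
      rw [Module.finrank_zero_of_subsingleton, zero_mul]
      exact Nat.zero_le _
    push Not at h0
    obtain ⟨f, hf⟩ := h0
    have hinj : Function.Injective f :=
      (Representation.IsIrreducible.injective_or_eq_zero f).resolve_right hf
    have hfi : ∀ (g : G) (v : V), f (π g v) = σ g (f v) := fun g v =>
      Representation.IntertwiningMap.isIntertwining _ _ f g v
    -- the image `N = f(V)`, a stable subspace, and the quotient representation `σ'` on `M ⧸ N`
    set N : Submodule ℚ M := LinearMap.range f.toLinearMap with hN
    have hNst : ∀ g, N ≤ N.comap (σ g) := by
      rintro g _ ⟨v, rfl⟩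
      exact ⟨π g v, hfi g v⟩
    let σ' : Representation ℚ G (M ⧸ N) := σ.quotient N hNst
    have hσ' : ∀ (g : G) (m : M), σ' g (N.mkQ m) = N.mkQ (σ g m) := fun g m => rfl
    -- `Θ : Hom_G(V, M) → Hom_G(V, M ⧸ N)`, `h ↦ mkQ ∘ h`
    let Θ : π.IntertwiningMap σ →ₗ[ℚ] π.IntertwiningMap σ' :=
      { toFun := fun h => ⟨N.mkQ ∘ₗ h.toLinearMap, fun g => LinearMap.ext fun v => by
            change N.mkQ (h (π g v)) = σ' g (N.mkQ (h v))
            rw [hσ', Representation.IntertwiningMap.isIntertwining _ _ h g v]⟩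
        map_add' := fun h₁ h₂ => Representation.IntertwiningMap.ext (by
          change N.mkQ ∘ₗ (h₁ + h₂).toLinearMap = N.mkQ ∘ₗ h₁.toLinearMap + N.mkQ ∘ₗ h₂.toLinearMap
          rw [Representation.IntertwiningMap.add_toLinearMap, LinearMap.comp_add])
        map_smul' := fun c h => Representation.IntertwiningMap.ext (by
          change N.mkQ ∘ₗ (c • h).toLinearMap = c • (N.mkQ ∘ₗ h.toLinearMap)
          rw [Representation.IntertwiningMap.toLinearMap_smul, LinearMap.comp_smul]) }
    have hΘ : ∀ (h : π.IntertwiningMap σ) (v : V), Θ h v = N.mkQ (h v) := fun h v => rfl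
    -- `Λ : End_G(V) → Hom_G(V, M)`, `e ↦ f ∘ e`; its range contains `ker Θ`
    let Λ : π.IntertwiningMap π →ₗ[ℚ] π.IntertwiningMap σ := Representation.IntertwiningMap.llcomp π π σ f
    have hΛ : ∀ (e : π.IntertwiningMap π) (v : V), Λ e v = f (e v) := fun e v => rfl
    have hker : LinearMap.ker Θ ≤ LinearMap.range Λ := by
      intro h hh
      have hhN : ∀ v, h v ∈ N := fun v => by
        have h1 : Θ h v = 0 := by
          rw [LinearMap.mem_ker] at hh
          rw [hh]
          rfl
        rw [hΘ] at h1
        exact (Submodule.Quotient.mk_eq_zero N).1 h1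
      -- `e = f⁻¹ ∘ h`
      let ε : V ≃ₗ[ℚ] N := LinearEquiv.ofInjective f.toLinearMap hinj
      have hε : ∀ v : V, ((ε v : N) : M) = f v := fun v => rfl
      let e : V →ₗ[ℚ] V := ε.symm.toLinearMap ∘ₗ LinearMap.codRestrict N h.toLinearMap hhN
      have hfe : ∀ v, f (e v) = h v := fun v => by
        change f (ε.symm ⟨h v, hhN v⟩) = h v
        rw [← hε, LinearEquiv.apply_symm_apply]
      have heq : ∀ g v, e (π g v) = π g (e v) := fun g v => hinj (by
        rw [hfe, Representation.IntertwiningMap.isIntertwining _ _ h g v, hfi g (e v), hfe])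
      refine ⟨⟨e, fun g => LinearMap.ext fun v => heq g v⟩, Representation.IntertwiningMap.ext (LinearMap.ext fun v => ?_)⟩
      change Λ _ v = h v
      rw [hΛ]
      exact hfe v
    -- dimension count
    have hdimV : Module.finrank ℚ N = Module.finrank ℚ V := LinearMap.finrank_range_of_inj hinj
    have hVpos : 0 < Module.finrank ℚ V := Module.finrank_pos
    have hquot : Module.finrank ℚ (M ⧸ N) + Module.finrank ℚ N = Module.finrank ℚ M :=
      N.finrank_quotient_add_finrank
    have hM' : Module.finrank ℚ (M ⧸ N) ≤ n := by omega
    have ih' := ih (M ⧸ N) σ' hM'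
    have hrank : Module.finrank ℚ (π.IntertwiningMap σ) ≤
        Module.finrank ℚ (π.IntertwiningMap σ') + Module.finrank ℚ (π.IntertwiningMap π) := by
      have h1 := LinearMap.finrank_range_add_finrank_ker Θ
      have h2 : Module.finrank ℚ (LinearMap.range Θ) ≤ Module.finrank ℚ (π.IntertwiningMap σ') :=
        Submodule.finrank_le _
      have h3 : Module.finrank ℚ (LinearMap.ker Θ) ≤ Module.finrank ℚ (π.IntertwiningMap π) :=
        (Submodule.finrank_mono hker).trans (LinearMap.finrank_range_le Λ)
      omega
    calc Module.finrank ℚ (π.IntertwiningMap σ) * Module.finrank ℚ V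
        ≤ (Module.finrank ℚ (π.IntertwiningMap σ') + Module.finrank ℚ (π.IntertwiningMap π)) *
            Module.finrank ℚ V := Nat.mul_le_mul_right _ hrank
      _ = Module.finrank ℚ (π.IntertwiningMap σ') * Module.finrank ℚ V +
            Module.finrank ℚ (π.IntertwiningMap π) * Module.finrank ℚ V := Nat.add_mul _ _ _
      _ ≤ Module.finrank ℚ (M ⧸ N) * Module.finrank ℚ (π.IntertwiningMap π) +
            Module.finrank ℚ (π.IntertwiningMap π) * Module.finrank ℚ V := Nat.add_le_add_right ih' _
      _ = (Module.finrank ℚ (M ⧸ N) + Module.finrank ℚ N) * Module.finrank ℚ (π.IntertwiningMap π) := by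
            rw [hdimV]; ring
      _ = Module.finrank ℚ M * Module.finrank ℚ (π.IntertwiningMap π) := by rw [hquot]

end HomCount

/-! ### §2 The index bound `dim_ℚ V ≤ [G : A] · dim_ℚ End_G(V)` -/

section IndexBound

variable {V : Type u'} [AddCommGroup V] [Module ℚ V] [FiniteDimensional ℚ V]

/-- **THE INDEX BOUND.**  Let `(π, V)` be an irreducible finite-dimensional `ℚ`-representation of a group `G` and
`A ≤ G` a subgroup of finite index whose elements act on `V` through PAIRWISE COMMUTING operators.  Then
`dim_ℚ V ≤ [G : A] · dim_ℚ End_G(V)` — equivalently `dim_D V ≤ [G : A]` over the division algebra `D = End_G(V)`; over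
`ℂ` (`D = ℂ`) this is «the degree of an irreducible representation is at most the index of an abelian subgroup».
Proof by coinduction from an `A`-irreducible quotient of `V|_A` and §1, see the module docstring.
[cite: Serre1977, §3.1 Cor. to Thm. 9, §7.2 and §12.2] -/
theorem finrank_le_index_mul_finrank_intertwiningMap (π : Representation ℚ G V) (hπ : π.IsIrreducible)
    (A : Subgroup G) [A.FiniteIndex] (hcomm : ∀ a ∈ A, ∀ b ∈ A, π a * π b = π b * π a) :
    Module.finrank ℚ V ≤ A.index * Module.finrank ℚ (π.IntertwiningMap π) := by
  classical
  haveI := hπ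
  haveI := nontrivial_of_isIrreducible π hπ
  -- a maximal proper `A`-stable subspace `W < V`
  obtain ⟨W, ⟨hWtop, hWst⟩, hWmax⟩ := set_has_maximal_iff_noetherian.2 (inferInstance : IsNoetherian ℚ V)
    {W : Submodule ℚ V | W ≠ ⊤ ∧ ∀ a ∈ A, W ≤ W.comap (π a)} ⟨⊥, bot_ne_top, fun a _ => bot_le⟩
  -- the quotient `Q = V ⧸ W` with its `A`-action `σ`
  let πA : Representation ℚ A V := π.comp A.subtype
  let σ : Representation ℚ A (V ⧸ W) := πA.quotient W fun a => hWst a a.2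
  have hσ : ∀ (a : A) (v : V), σ a (W.mkQ v) = W.mkQ (π a v) := fun a v => rfl
  -- `Q` is `A`-irreducible
  have hQirr : ∀ U : Submodule ℚ (V ⧸ W), (∀ a : A, U ≤ U.comap (σ a)) → U ≠ ⊥ → U = ⊤ := by
    intro U hU hU0
    have hle : W ≤ U.comap W.mkQ := fun w hw => by
      rw [Submodule.mem_comap, Submodule.mkQ_apply, (Submodule.Quotient.mk_eq_zero W).2 hw]
      exact U.zero_mem
    by_contra hUtop
    have hmem : U.comap W.mkQ ∈ {W : Submodule ℚ V | W ≠ ⊤ ∧ ∀ a ∈ A, W ≤ W.comap (π a)} := by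
      refine ⟨fun htop => hUtop ?_, fun a ha v hv => ?_⟩
      · rw [← Submodule.map_comap_eq_of_surjective (Submodule.mkQ_surjective W) U, htop, Submodule.map_top,
          Submodule.range_mkQ]
      · change W.mkQ (π a v) ∈ U
        rw [← hσ ⟨a, ha⟩ v]
        exact hU ⟨a, ha⟩ hv
    have heq : U.comap W.mkQ = W := (eq_of_le_of_not_lt hle (hWmax _ hmem)).symm
    apply hU0
    rw [← Submodule.map_comap_eq_of_surjective (Submodule.mkQ_surjective W) U, heq, Submodule.mkQ_map_self]
  -- `Q ≠ 0`
  obtain ⟨q₀, hq₀⟩ : ∃ q : V ⧸ W, q ≠ 0 := by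
    obtain ⟨v, hv⟩ : ∃ v : V, v ∉ W := by
      by_contra hall
      push Not at hall
      exact hWtop (Submodule.eq_top_iff'.2 hall)
    exact ⟨W.mkQ v, fun h => hv ((Submodule.Quotient.mk_eq_zero W).1 h)⟩
  have hfpos : 0 < Module.finrank ℚ (V ⧸ W) := Module.finrank_pos_iff_exists_ne_zero.2 ⟨q₀, hq₀⟩
  -- the (commutative) span `R` of the image of `A` in `End(Q)`
  let R : Submodule ℚ (Module.End ℚ (V ⧸ W)) := Submodule.span ℚ (Set.range fun a : A => (σ a : Module.End ℚ (V ⧸ W)))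
  have hσcomm : ∀ a b : A, (σ a : Module.End ℚ (V ⧸ W)) ∘ₗ σ b = σ b ∘ₗ σ a := fun a b => by
    refine LinearMap.ext fun q => ?_
    obtain ⟨v, rfl⟩ := Submodule.mkQ_surjective W q
    rw [LinearMap.comp_apply, LinearMap.comp_apply, hσ, hσ, hσ, hσ]
    exact congrArg W.mkQ (LinearMap.congr_fun (hcomm a a.2 b b.2) v)
  have hRcomm : ∀ x ∈ R, ∀ a : A, x ∘ₗ (σ a : Module.End ℚ (V ⧸ W)) = σ a ∘ₗ x := by
    intro x hx a
    induction hx using Submodule.span_induction with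
    | mem y hy =>
      obtain ⟨b, rfl⟩ := hy
      exact hσcomm b a
    | zero => rw [LinearMap.zero_comp, LinearMap.comp_zero]
    | add y z _ _ hy hz => rw [LinearMap.add_comp, LinearMap.comp_add, hy, hz]
    | smul c y _ hy => rw [LinearMap.smul_comp, LinearMap.comp_smul, hy]
  have hRmul : ∀ x ∈ R, ∀ a : A, (σ a : Module.End ℚ (V ⧸ W)) ∘ₗ x ∈ R := by
    intro x hx a
    induction hx using Submodule.span_induction with
    | mem y hy =>
      obtain ⟨b, rfl⟩ := hy
      refine Submodule.subset_span ⟨a * b, ?_⟩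
      change σ (a * b) = _
      rw [map_mul]
      rfl
    | zero => rw [LinearMap.comp_zero]; exact R.zero_mem
    | add y z _ _ hy hz => rw [LinearMap.comp_add]; exact R.add_mem hy hz
    | smul c y _ hy => rw [LinearMap.comp_smul]; exact R.smul_mem c hy
  -- `f ≤ dim R`: `R · q₀` is a non-zero stable subspace of the irreducible `Q`
  have hfR : Module.finrank ℚ (V ⧸ W) ≤ Module.finrank ℚ R := by
    let ev : Module.End ℚ (V ⧸ W) →ₗ[ℚ] (V ⧸ W) := LinearMap.applyₗ q₀
    have hev : ∀ x : Module.End ℚ (V ⧸ W), ev x = x q₀ := fun x => rfl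
    have htop : R.map ev = ⊤ := by
      refine hQirr _ (fun a y hy => ?_) fun h => hq₀ ?_
      · obtain ⟨x, hx, rfl⟩ := hy
        refine ⟨σ a ∘ₗ x, hRmul x hx a, ?_⟩
        rw [hev, hev, LinearMap.comp_apply]
      · have hmem : q₀ ∈ R.map ev :=
          ⟨LinearMap.id, Submodule.subset_span ⟨1, by change σ 1 = 1; exact map_one σ⟩, rfl⟩
        rw [h] at hmem
        exact (Submodule.mem_bot ℚ).1 hmem
    calc Module.finrank ℚ (V ⧸ W) = Module.finrank ℚ (⊤ : Submodule ℚ (V ⧸ W)) := (finrank_top ℚ (V ⧸ W)).symm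
      _ = Module.finrank ℚ (R.map ev) := by rw [htop]
      _ ≤ Module.finrank ℚ R := Submodule.finrank_map_le ev R
  -- the coinduced representation `M = Coind_A^G Q`, of dimension `≤ [G:A] · f`
  let τ : Representation ℚ G (Representation.coindV A.subtype σ) := Representation.coind A.subtype σ
  have hτ : ∀ (g h : G) (m : Representation.coindV A.subtype σ), (τ g m : G → V ⧸ W) h = (m : G → V ⧸ W) (h * g) :=
    fun g h m => rfl
  let Qc := Quotient (QuotientGroup.rightRel A)
  haveI : Finite Qc := Finite.of_equiv _ (QuotientGroup.quotientRightRelEquivQuotientLeftRel A).symm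
  letI : Fintype Qc := Fintype.ofFinite Qc
  let res : Representation.coindV A.subtype σ →ₗ[ℚ] (Qc → V ⧸ W) :=
    { toFun := fun m q => (m : G → V ⧸ W) q.out
      map_add' := fun _ _ => rfl
      map_smul' := fun _ _ => rfl }
  have hres : Function.Injective res := by
    refine (injective_iff_map_eq_zero res).2 fun m hm => Subtype.ext (funext fun h => ?_)
    have hrel : h * (Quotient.mk (QuotientGroup.rightRel A) h).out⁻¹ ∈ A :=
      QuotientGroup.rightRel_apply.1 (Quotient.mk_out h)
    have h1 := m.2 ⟨_, hrel⟩ (Quotient.mk (QuotientGroup.rightRel A) h).out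
    have h2 : res m (Quotient.mk (QuotientGroup.rightRel A) h) = 0 := by rw [hm]; rfl
    change (m : G → V ⧸ W) (Quotient.mk (QuotientGroup.rightRel A) h).out = 0 at h2
    rw [A.coe_subtype, inv_mul_cancel_right, h2, map_zero] at h1
    exact h1
  haveI : FiniteDimensional ℚ (Representation.coindV A.subtype σ) := Module.Finite.of_injective res hres
  have hM : Module.finrank ℚ (Representation.coindV A.subtype σ) ≤ A.index * Module.finrank ℚ (V ⧸ W) := by
    have hcard : Fintype.card Qc = A.index := by
      rw [A.index_eq_card, ← Nat.card_eq_fintype_card]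
      exact Nat.card_congr (QuotientGroup.quotientRightRelEquivQuotientLeftRel A)
    calc Module.finrank ℚ (Representation.coindV A.subtype σ) ≤ Module.finrank ℚ (Qc → V ⧸ W) :=
          LinearMap.finrank_le_finrank_of_injective hres
      _ = A.index * Module.finrank ℚ (V ⧸ W) := by
          rw [Module.finrank_pi_fintype, Finset.sum_const, smul_eq_mul, Finset.card_univ, hcard]
  -- `R ↪ Hom_G(V, M)`: `x ↦ (v ↦ (h ↦ x (π(h)v mod W)))`
  let jx : ∀ x : R, V →ₗ[ℚ] Representation.coindV A.subtype σ := fun x =>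
    { toFun := fun v => ⟨fun h => (x : Module.End ℚ (V ⧸ W)) (W.mkQ (π h v)), fun a h => by
          change (x : Module.End ℚ (V ⧸ W)) (W.mkQ (π ((a : G) * h) v)) =
            σ a ((x : Module.End ℚ (V ⧸ W)) (W.mkQ (π h v)))
          rw [map_mul, Module.End.mul_apply, ← hσ]
          exact LinearMap.congr_fun (hRcomm x x.2 a) _⟩
      map_add' := fun v v' => Subtype.ext (funext fun h => by
        change (x : Module.End ℚ (V ⧸ W)) (W.mkQ (π h (v + v'))) =
          (x : Module.End ℚ (V ⧸ W)) (W.mkQ (π h v)) + (x : Module.End ℚ (V ⧸ W)) (W.mkQ (π h v'))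
        rw [map_add, map_add, map_add])
      map_smul' := fun c v => Subtype.ext (funext fun h => by
        change (x : Module.End ℚ (V ⧸ W)) (W.mkQ (π h (c • v))) = c • (x : Module.End ℚ (V ⧸ W)) (W.mkQ (π h v))
        rw [map_smul, map_smul, map_smul]) }
  have hjx : ∀ (x : R) (v : V) (h : G), (jx x v : G → V ⧸ W) h = (x : Module.End ℚ (V ⧸ W)) (W.mkQ (π h v)) :=
    fun x v h => rfl
  let J : R →ₗ[ℚ] π.IntertwiningMap τ :=
    { toFun := fun x => ⟨jx x, fun g => LinearMap.ext fun v => Subtype.ext (funext fun h => by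
          change (jx x (π g v) : G → V ⧸ W) h = (τ g (jx x v) : G → V ⧸ W) h
          rw [hτ, hjx, hjx, map_mul, Module.End.mul_apply])⟩
      map_add' := fun x y => Representation.IntertwiningMap.ext (LinearMap.ext fun v => Subtype.ext (funext fun h => by
        change (jx (x + y) v : G → V ⧸ W) h = (jx x v : G → V ⧸ W) h + (jx y v : G → V ⧸ W) h
        rw [hjx, hjx, hjx]
        rfl))
      map_smul' := fun c x => Representation.IntertwiningMap.ext (LinearMap.ext fun v => Subtype.ext (funext fun h => by
        change (jx (c • x) v : G → V ⧸ W) h = c • (jx x v : G → V ⧸ W) h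
        rw [hjx, hjx]
        rfl)) }
  have hJ : Function.Injective J := by
    intro x y hxy
    refine Subtype.ext (LinearMap.ext fun q => ?_)
    obtain ⟨v, rfl⟩ := Submodule.mkQ_surjective W q
    have h2 : ((J x v : Representation.coindV A.subtype σ) : G → V ⧸ W) 1 =
        ((J y v : Representation.coindV A.subtype σ) : G → V ⧸ W) 1 := by rw [hxy]
    change (jx x v : G → V ⧸ W) 1 = (jx y v : G → V ⧸ W) 1 at h2
    rwa [hjx, hjx, map_one, Module.End.one_apply] at h2
  -- assemble: `f · d ≤ dim R · d ≤ dim Hom_G(V, M) · d ≤ dim M · δ ≤ [G:A] · f · δ`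
  have hchain : Module.finrank ℚ (V ⧸ W) * Module.finrank ℚ V ≤
      Module.finrank ℚ (V ⧸ W) * (A.index * Module.finrank ℚ (π.IntertwiningMap π)) :=
    calc Module.finrank ℚ (V ⧸ W) * Module.finrank ℚ V
        ≤ Module.finrank ℚ R * Module.finrank ℚ V := Nat.mul_le_mul_right _ hfR
      _ ≤ Module.finrank ℚ (π.IntertwiningMap τ) * Module.finrank ℚ V :=
          Nat.mul_le_mul_right _ (LinearMap.finrank_le_finrank_of_injective hJ)
      _ ≤ Module.finrank ℚ (Representation.coindV A.subtype σ) * Module.finrank ℚ (π.IntertwiningMap π) :=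
          finrank_intertwiningMap_mul_finrank_le π hπ τ
      _ ≤ A.index * Module.finrank ℚ (V ⧸ W) * Module.finrank ℚ (π.IntertwiningMap π) :=
          Nat.mul_le_mul_right _ hM
      _ = Module.finrank ℚ (V ⧸ W) * (A.index * Module.finrank ℚ (π.IntertwiningMap π)) := by ring
  exact Nat.le_of_mul_le_mul_left hchain hfpos

/-- **Abelian subgroups**: if `A ≤ G` is ABELIAN of finite index, every irreducible finite-dimensional
`ℚ`-representation `V` of `G` has `dim_ℚ V ≤ [G : A] · dim_ℚ End_G(V)`. [cite: Serre1977, §3.1 Cor. to Thm. 9 and §12.2] -/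
theorem finrank_le_index_mul_finrank_intertwiningMap_of_comm (π : Representation ℚ G V) (hπ : π.IsIrreducible)
    (A : Subgroup G) [A.FiniteIndex] (hA : ∀ a ∈ A, ∀ b ∈ A, a * b = b * a) :
    Module.finrank ℚ V ≤ A.index * Module.finrank ℚ (π.IntertwiningMap π) :=
  finrank_le_index_mul_finrank_intertwiningMap π hπ A fun a ha b hb => by rw [← map_mul, hA a ha b hb, map_mul]

/-- **The whole group**: if `G` acts on the irreducible `V` through pairwise commuting operators (e.g. `G` abelian),
then `dim_ℚ V = dim_ℚ End_G(V)` — `V` is a line over the division algebra `End_G(V)` (the case `[G : G] = 1`; the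
reverse inequality `dim End_G(V) ≤ dim V` is evaluation at a non-zero vector, injective by Schur).
[cite: Serre1977, §3.1 Thm. 9 and §12.2] -/
theorem finrank_eq_finrank_intertwiningMap_of_comm (π : Representation ℚ G V) (hπ : π.IsIrreducible)
    (hcomm : ∀ a b : G, π a * π b = π b * π a) :
    Module.finrank ℚ V = Module.finrank ℚ (π.IntertwiningMap π) := by
  haveI := hπ
  haveI := nontrivial_of_isIrreducible π hπ
  refine le_antisymm ?_ ?_
  · have h := finrank_le_index_mul_finrank_intertwiningMap π hπ ⊤ fun a _ b _ => hcomm a b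
    rwa [Subgroup.index_top, one_mul] at h
  · -- evaluation at `v₀ ≠ 0` is injective on `End_G(V)`
    obtain ⟨v₀, hv₀⟩ := exists_ne (0 : V)
    let ev : π.IntertwiningMap π →ₗ[ℚ] V :=
      { toFun := fun e => e v₀
        map_add' := fun _ _ => rfl
        map_smul' := fun _ _ => rfl }
    refine LinearMap.finrank_le_finrank_of_injective (f := ev) ((injective_iff_map_eq_zero ev).2 fun e he => ?_)
    change e v₀ = 0 at he
    rcases Representation.IsIrreducible.injective_or_eq_zero e with hinj | h0
    · exact absurd (hinj (by rw [he, map_zero])) hv₀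
    · exact h0

end IndexBound

end Literature.RepresentationTheory.IrrOdd

end
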